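import Mathlib
import Literature.Combinatorics.Enumerative.DerivativePolynomialCompositionRelations
import HarnessLib

/-!
# Values of the derivative polynomials at `√3` (Hoffman 1999, §3: eqs. (6), (7), Theorems 3.2 and 3.3)

[cite: Hoffman1999DerivativePolynomials, §3 «Values of derivative polynomials at √3» — eqs. (6), (7), Theorem 3.2, Theorem 3.3 (Electron. J. Combin. 6 (1999) #R21, pp. 4–6)]

Continues `DerivativePolynomialGeneratingFunctions` (closed forms (1), `u = 0, 1`, Theorem 3.1, parity Theorem 2.1)
and `DerivativePolynomialCompositionRelations` (Theorem 2.2) with Hoffman's §3 results at `u = √3`.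

## Source (verbatim)

* «Theorem 3.2. i. If n is odd, Pₙ(√3) = ½(3ⁿ⁺¹ − 1)Pₙ(0).  ii. If n is even, Qₙ(√3) = ¼(3ⁿ⁺¹ + 1)Qₙ(0).
  Proof. Note first that cos 3t = cos t(2 cos 2t − 1), by the addition formula for cosine and the double-angle
  formulas for sine and cosine. Then P(√3,t) = (sin t + √3 cos t)/(cos t − √3 sin t) = (√3 + 2 sin 2t)/(2cos 2t − 1)
  = (√3 + 2 sin 2t) cos t/cos 3t, while on the other hand 3P(0,3t) − P(0,t) = … = 4 sin 2t cos t/cos 3t.  Thus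
  (6) P(√3,t) − ½(3P(0,3t) − P(0,t)) = √3 cos t/cos 3t,
  and (i) follows from consideration of the coefficient of tⁿ/n!, n odd (Note the right-hand side is an even
  function). A similar argument proves the identity
  (7) Q(√3,t) − ¼(3Q(0,3t) + Q(0,t)) = √3 sin 2t/(2 cos 3t),
  from which (ii) follows upon the observation that the right-hand side is an odd function.»
* «Theorem 3.3. i. If n > 0 is even, Pₙ(√3) can be computed from the tangent numbers P_k(0) via
  Pₙ(√3) = (√3/2) Σ_{k odd} binom(n,k)(3^{k+1} − 1)P_k(0)P_{n−k}(0).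
  ii. If n is odd, Qₙ(√3) can be computed from the tangent numbers P_k(0) and the secant numbers Q_k(0) via
  Qₙ(√3) = (√3/8) Σ_{k odd} binom(n,k)(3^{k+1} − 1)P_k(0)Q_{n−k}(0).
  Proof. For (i), set s = π/3 and u = 0 in Theorem 2.2(i) … For (ii), proceed similarly after setting s = π/3 and
  u = −√3 in Theorem 2.2(ii).»

## What is typed, and how

Everything is stated over a field `K ⊇ ℚ` for an element `r` with `r² = 3` (§4 specialises to `ℝ`, `r = √3`).

* §0 formal triple-angle formulas `sin 3t = 3 sin t cos²t − sin³t`, `cos 3t = cos³t − 3 sin²t cos t`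
  (`rescale_three_sin/cos`, by the uniqueness lemma `eq_zero_of_linear_system` of the first file) and Hoffman's
  `cos 3t = cos t(2cos 2t − 1)`; `P(0,3t)cos 3t = sin 3t`, `Q(0,3t) cos 3t = 1`.
* §1 **(6) and (7)** as printed (`egfP_sqrt_three_eq`, `egfQ_sqrt_three_eq`) and in *symmetrised* form
  (`egfP_add_egfP_neg_add`: `P(r,t) + P(−r,t) + P(0,t) = 3P(0,3t)`; `two_mul_egfQ_add_egfQ_neg`:
  `2(Q(r,t) + Q(−r,t)) = 3Q(0,3t) + Q(0,t)`) — the latter are exactly the statements «the right-hand side is an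
  even/odd function», since `P(u,−t) = −P(−u,t)` and `Q(u,−t) = Q(−u,t)`.  Each identity is one polynomial
  certificate (`linear_combination`) against the unit relations `D·D⁻¹ = 1` of the denominators, after clearing
  `cos 3t`.
* §2 **Theorem 3.2** (`aeval_sqrt_three_P`, `aeval_sqrt_three_Q`): the coefficient of `tⁿ/n!` of the symmetrised
  identities and the parity `Pₙ(−u) = (−1)ⁿ⁺¹Pₙ(u)`, `Qₙ(−u) = (−1)ⁿQₙ(u)` (Theorem 2.1).
* §3 **Theorem 3.3** (`aeval_sqrt_three_P_even`, `aeval_sqrt_three_Q_odd`) exactly along the printed proof: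
  Theorem 2.2 at `(u, tan s) = (0, √3)` resp. `(−√3, √3)` (where `P(−√3, π/3) = 0`), Theorem 3.2(i) for the odd
  indices, vanishing of `P_{2j}(0)`, `Q_{2j+1}(0)` for the others, and `k ↦ n − k`.
* §4 `ℝ`, `r = √3`; values `P₁(√3) = 4`, `P₃(√3) = 80`, `Q₂(√3) = 7`.

No new named facts (net debt 0).
-/

namespace Literature.Combinatorics.Enumerative
namespace DerivativePolynomials

open PowerSeries Finset
open scoped Nat
open Literature.ComputerArithmetic.BrentZimmermann2010

section Field

variable {K : Type*} [Field K] [CharZero K]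

/-! ### §0 Formal triple-angle formulas -/

/-- **`sin 3t = 3 sin t cos²t − sin³t`** in `K⟦t⟧` (the solution of `y′ = 3z`, `z′ = −3y` through `(0,1)` is unique).
[cite: Hoffman1999DerivativePolynomials, §3 proof of Theorem 3.2 («by the addition formula for cosine and the double-angle formulas for sine and cosine»)] -/
theorem rescale_three_sin :
    rescale 3 (PowerSeries.sin K) = 3 * PowerSeries.sin K * PowerSeries.cos K ^ 2 - PowerSeries.sin K ^ 3 := by
  have h := eq_zero_of_linear_system (K := K)
    (y := rescale 3 (PowerSeries.sin K) - (3 * PowerSeries.sin K * PowerSeries.cos K ^ 2 - PowerSeries.sin K ^ 3))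
    (z := rescale 3 (PowerSeries.cos K) - (PowerSeries.cos K ^ 3 - 3 * PowerSeries.sin K ^ 2 * PowerSeries.cos K)) 3
    (by
      have h3 : d⁄dX K (3 : K⟦X⟧) = 0 := by
        rw [show (3 : K⟦X⟧) = C (3 : K) from (map_ofNat C 3).symm, derivative_C]
      rw [map_sub, derivative_rescale, derivative_sin_eq, map_sub, Derivation.leibniz, Derivation.leibniz,
        Derivation.leibniz_pow, Derivation.leibniz_pow, derivative_sin_eq, derivative_cos_eq, h3, map_ofNat C]
      simp only [smul_eq_mul, nsmul_eq_mul]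
      push_cast
      ring)
    (by
      rw [map_sub, derivative_rescale, derivative_cos_eq, map_neg, map_sub, Derivation.leibniz_pow,
        Derivation.leibniz, Derivation.leibniz, Derivation.leibniz_pow, derivative_sin_eq, derivative_cos_eq,
        map_ofNat C]
      have h3 : d⁄dX K (3 : K⟦X⟧) = 0 := by
        rw [show (3 : K⟦X⟧) = C (3 : K) from (map_ofNat C 3).symm, derivative_C]
      rw [h3]
      simp only [smul_eq_mul, nsmul_eq_mul]
      push_cast
      ring)
    (by
      rw [map_sub, ← coeff_zero_eq_constantCoeff_apply, coeff_rescale, pow_zero, one_mul,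
        coeff_zero_eq_constantCoeff_apply, map_sub, map_mul, map_mul, map_pow, map_pow, constantCoeff_sin_eq]
      ring)
    (by
      rw [map_sub, ← coeff_zero_eq_constantCoeff_apply, coeff_rescale, pow_zero, one_mul,
        coeff_zero_eq_constantCoeff_apply, map_sub, map_mul, map_mul, map_pow, map_pow, constantCoeff_sin_eq,
        constantCoeff_cos_eq]
      ring)
  exact sub_eq_zero.1 h.1

/-- **`cos 3t = cos³t − 3 sin²t cos t`** (`= cos t(2cos 2t − 1) = 4cos³t − 3cos t`) in `K⟦t⟧`.
[cite: Hoffman1999DerivativePolynomials, §3 proof of Theorem 3.2 («cos 3t = cos t(2 cos 2t − 1)»)] -/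
theorem rescale_three_cos :
    rescale 3 (PowerSeries.cos K) = PowerSeries.cos K ^ 3 - 3 * PowerSeries.sin K ^ 2 * PowerSeries.cos K := by
  have h := eq_zero_of_linear_system (K := K)
    (y := rescale 3 (PowerSeries.sin K) - (3 * PowerSeries.sin K * PowerSeries.cos K ^ 2 - PowerSeries.sin K ^ 3))
    (z := rescale 3 (PowerSeries.cos K) - (PowerSeries.cos K ^ 3 - 3 * PowerSeries.sin K ^ 2 * PowerSeries.cos K)) 3
    (by
      have h3 : d⁄dX K (3 : K⟦X⟧) = 0 := by
        rw [show (3 : K⟦X⟧) = C (3 : K) from (map_ofNat C 3).symm, derivative_C]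
      rw [map_sub, derivative_rescale, derivative_sin_eq, map_sub, Derivation.leibniz, Derivation.leibniz,
        Derivation.leibniz_pow, Derivation.leibniz_pow, derivative_sin_eq, derivative_cos_eq, h3, map_ofNat C]
      simp only [smul_eq_mul, nsmul_eq_mul]
      push_cast
      ring)
    (by
      rw [map_sub, derivative_rescale, derivative_cos_eq, map_neg, map_sub, Derivation.leibniz_pow,
        Derivation.leibniz, Derivation.leibniz, Derivation.leibniz_pow, derivative_sin_eq, derivative_cos_eq,
        map_ofNat C]
      have h3 : d⁄dX K (3 : K⟦X⟧) = 0 := by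
        rw [show (3 : K⟦X⟧) = C (3 : K) from (map_ofNat C 3).symm, derivative_C]
      rw [h3]
      simp only [smul_eq_mul, nsmul_eq_mul]
      push_cast
      ring)
    (by
      rw [map_sub, ← coeff_zero_eq_constantCoeff_apply, coeff_rescale, pow_zero, one_mul,
        coeff_zero_eq_constantCoeff_apply, map_sub, map_mul, map_mul, map_pow, map_pow, constantCoeff_sin_eq]
      ring)
    (by
      rw [map_sub, ← coeff_zero_eq_constantCoeff_apply, coeff_rescale, pow_zero, one_mul,
        coeff_zero_eq_constantCoeff_apply, map_sub, map_mul, map_mul, map_pow, map_pow, constantCoeff_sin_eq,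
        constantCoeff_cos_eq]
      ring)
  exact sub_eq_zero.1 h.2

/-- Hoffman's form: `cos 3t = cos t (2cos 2t − 1)`. [cite: Hoffman1999DerivativePolynomials, §3 proof of Theorem 3.2 («Note first that cos 3t = cos t(2 cos 2t − 1)»)] -/
theorem rescale_three_cos_eq_mul :
    rescale 3 (PowerSeries.cos K) = PowerSeries.cos K * (2 * rescale 2 (PowerSeries.cos K) - 1) := by
  rw [rescale_three_cos, rescale_two_cos]
  linear_combination (-PowerSeries.cos K) * sin_sq_add_cos_sq_eq (K := K)

/-- `P(0,3t)·cos 3t = sin 3t` (`P(0,·) = tan`). [cite: Hoffman1999DerivativePolynomials, §3 eq. (6) («3P(0,3t)»)] -/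
theorem rescale_three_egfP_zero_mul :
    rescale 3 (egfP (0 : K)) * (PowerSeries.cos K ^ 3 - 3 * PowerSeries.sin K ^ 2 * PowerSeries.cos K) =
      3 * PowerSeries.sin K * PowerSeries.cos K ^ 2 - PowerSeries.sin K ^ 3 := by
  have h := congrArg (rescale (3 : K)) (egfP_mul_den (0 : K))
  simp only [map_zero, zero_mul, sub_zero, add_zero, map_mul] at h
  rwa [rescale_three_cos, rescale_three_sin] at h

/-- `Q(0,3t)·cos 3t = 1` (`Q(0,·) = sec`). [cite: Hoffman1999DerivativePolynomials, §3 eq. (7) («3Q(0,3t)»)] -/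
theorem rescale_three_egfQ_zero_mul :
    rescale 3 (egfQ (0 : K)) * (PowerSeries.cos K ^ 3 - 3 * PowerSeries.sin K ^ 2 * PowerSeries.cos K) = 1 := by
  have h := congrArg (rescale (3 : K)) (egfQ_mul_den (0 : K))
  simp only [map_zero, zero_mul, sub_zero, map_mul, map_one] at h
  rwa [rescale_three_cos] at h

/-- `P(0,t)·cos t = sin t`. [cite: Hoffman1999DerivativePolynomials, §3 («P(0,t)» = tan t)] -/
theorem egfP_zero_mul_cos : egfP (0 : K) * PowerSeries.cos K = PowerSeries.sin K := by
  have h := egfP_mul_den (0 : K)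
  simp only [map_zero, zero_mul, sub_zero, add_zero] at h
  exact h

/-- `Q(0,t)·cos t = 1`. [cite: Hoffman1999DerivativePolynomials, §3 («Q(0,t)» = sec t)] -/
theorem egfQ_zero_mul_cos : egfQ (0 : K) * PowerSeries.cos K = 1 := by
  have h := egfQ_mul_den (0 : K)
  simp only [map_zero, zero_mul, sub_zero] at h
  exact h

/-- The product of the three denominators is a unit. [folklore] -/
private theorem den_prod_ne_zero (r : K) :
    (PowerSeries.cos K - C r * PowerSeries.sin K) * (PowerSeries.cos K - C (-r) * PowerSeries.sin K) *
      PowerSeries.cos K ≠ 0 := by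
  intro h0
  have := congrArg constantCoeff h0
  rw [map_mul, map_mul, constantCoeff_den, constantCoeff_den, constantCoeff_cos_eq, map_zero] at this
  norm_num at this

/-! ### §1 Equations (6) and (7) in symmetrised form -/

/-- ★★ **Equation (6), symmetrised**: for `r² = 3`, `P(r,t) + P(−r,t) + P(0,t) = 3P(0,3t)` — i.e. the right-hand
side `√3 cos t/cos 3t` of (6) «is an even function» (`P(u,−t) = −P(−u,t)`); classically
`tan(t+π/3) + tan(t−π/3) + tan t = 3 tan 3t`.
[cite: Hoffman1999DerivativePolynomials, §3 eq. (6) («P(√3,t) − ½(3P(0,3t) − P(0,t)) = √3 cos t/cos 3t … Note the right-hand side is an even function»)] -/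
theorem egfP_add_egfP_neg_add {r : K} (hr : r ^ 2 = 3) :
    egfP r + egfP (-r) + egfP 0 = 3 * rescale 3 (egfP 0) := by
  have hXp := den_mul_inv r
  have hXm := den_mul_inv (-r)
  have hT := egfP_zero_mul_cos (K := K)
  have hT3 := rescale_three_egfP_zero_mul (K := K)
  have hr' : (C r : K⟦X⟧) ^ 2 = 3 := by rw [← map_pow, hr, map_ofNat]
  apply mul_right_cancel₀ (den_prod_ne_zero r)
  rw [egfP_eq r, egfP_eq (-r)]
  set s := PowerSeries.sin K
  set c := PowerSeries.cos K
  set Xp := (c - C r * s)⁻¹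
  set Xm := (c - C (-r) * s)⁻¹
  set T := egfP (0 : K)
  set T3 := rescale 3 (egfP (0 : K))
  simp only [map_neg] at hXm ⊢
  linear_combination ((s + C r * c) * (c + C r * s) * c) * hXp + ((s - C r * c) * (c - C r * s) * c) * hXm +
    ((c - C r * s) * (c + C r * s)) * hT + (2 * s * c ^ 2 - s ^ 3 + 3 * T3 * s ^ 2 * c) * hr' - 3 * hT3

/-- ★★ **Equation (7), symmetrised**: for `r² = 3`, `2(Q(r,t) + Q(−r,t)) = 3Q(0,3t) + Q(0,t)` — the right-hand side
`√3 sin 2t/(2 cos 3t)` of (7) «is an odd function» (`Q(u,−t) = Q(−u,t)`).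
[cite: Hoffman1999DerivativePolynomials, §3 eq. (7) («Q(√3,t) − ¼(3Q(0,3t) + Q(0,t)) = √3 sin 2t/(2 cos 3t) … the right-hand side is an odd function»)] -/
theorem two_mul_egfQ_add_egfQ_neg {r : K} (hr : r ^ 2 = 3) :
    2 * (egfQ r + egfQ (-r)) = 3 * rescale 3 (egfQ 0) + egfQ 0 := by
  have hXp := den_mul_inv r
  have hXm := den_mul_inv (-r)
  have hc := egfQ_zero_mul_cos (K := K)
  have hQ3 := rescale_three_egfQ_zero_mul (K := K)
  have hr' : (C r : K⟦X⟧) ^ 2 = 3 := by rw [← map_pow, hr, map_ofNat]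
  apply mul_right_cancel₀ (den_prod_ne_zero r)
  rw [egfQ_eq r, egfQ_eq (-r)]
  set s := PowerSeries.sin K
  set c := PowerSeries.cos K
  set Xp := (c - C r * s)⁻¹
  set Xm := (c - C (-r) * s)⁻¹
  set ci := egfQ (0 : K)
  set Q3 := rescale 3 (egfQ (0 : K))
  simp only [map_neg] at hXm ⊢
  linear_combination (2 * (c + C r * s) * c) * hXp + (2 * (c - C r * s) * c) * hXm + 3 * sin_sq_add_cos_sq_eq (K := K) +
    (s ^ 2 + 3 * Q3 * s ^ 2 * c) * hr' - 3 * hQ3 - ((c - C r * s) * (c + C r * s)) * hc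

/-- `cos 3t` (in the cubic form) is a unit of `K⟦t⟧`. [folklore] -/
private theorem cos_three_poly_ne_zero :
    PowerSeries.cos K ^ 3 - 3 * PowerSeries.sin K ^ 2 * PowerSeries.cos K ≠ 0 := by
  intro h0
  have := congrArg constantCoeff h0
  rw [map_sub, map_pow, map_mul, map_mul, map_pow, constantCoeff_cos_eq, constantCoeff_sin_eq, map_zero] at this
  norm_num at this

/-- ★★ **Equation (6)** as printed: for `r² = 3`,
`P(r,t) − ½(3P(0,3t) − P(0,t)) = r·cos t/cos 3t`.
[cite: Hoffman1999DerivativePolynomials, §3 eq. (6) («P(√3,t) − ½(3P(0,3t) − P(0,t)) = √3 cos t / cos 3t»)] -/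
theorem egfP_sqrt_three_eq {r : K} (hr : r ^ 2 = 3) :
    egfP r - C (2 : K)⁻¹ * (3 * rescale 3 (egfP 0) - egfP 0) =
      C r * PowerSeries.cos K * (rescale 3 (PowerSeries.cos K))⁻¹ := by
  have hXp := den_mul_inv r
  have hT := egfP_zero_mul_cos (K := K)
  have hT3 := rescale_three_egfP_zero_mul (K := K)
  have hr' : (C r : K⟦X⟧) ^ 2 = 3 := by rw [← map_pow, hr, map_ofNat]
  have h2 : (C (2 : K)⁻¹ : K⟦X⟧) * 2 = 1 := by
    rw [← map_ofNat C 2, ← map_mul, inv_mul_cancel₀ (two_ne_zero), map_one]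
  have hC3 := rescale_three_cos (K := K)
  have hY : rescale 3 (PowerSeries.cos K) * (rescale 3 (PowerSeries.cos K))⁻¹ = 1 :=
    PowerSeries.mul_inv_cancel _ (by
      rw [hC3, map_sub, map_pow, map_mul, map_mul, map_pow, constantCoeff_cos_eq, constantCoeff_sin_eq]; norm_num)
  have hsc := sin_sq_add_cos_sq_eq (K := K)
  apply mul_right_cancel₀ (cos_three_poly_ne_zero (K := K))
  rw [egfP_eq r]
  set s := PowerSeries.sin K
  set c := PowerSeries.cos K
  set Xp := (c - C r * s)⁻¹
  set T := egfP (0 : K)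
  set T3 := rescale 3 (egfP (0 : K))
  set C3r := rescale 3 c
  set Y := C3r⁻¹
  set ι₂ : K⟦X⟧ := C (2 : K)⁻¹
  linear_combination ((s + C r * c) * (c + C r * s) * c) * hXp + ((s + C r * c) * s ^ 2 * c * Xp + s * c ^ 2) * hr' -
    3 * ι₂ * hT3 + ι₂ * (c ^ 2 - 3 * s ^ 2) * hT - 4 * s * c ^ 2 * h2 + C r * c * hsc - C r * c * hY +
    C r * c * Y * hC3

/-- ★★ **Equation (7)** as printed: for `r² = 3`,
`Q(r,t) − ¼(3Q(0,3t) + Q(0,t)) = (r/2)·sin 2t/cos 3t`.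
[cite: Hoffman1999DerivativePolynomials, §3 eq. (7) («Q(√3,t) − ¼(3Q(0,3t) + Q(0,t)) = √3 sin 2t/(2 cos 3t)»)] -/
theorem egfQ_sqrt_three_eq {r : K} (hr : r ^ 2 = 3) :
    egfQ r - C (4 : K)⁻¹ * (3 * rescale 3 (egfQ 0) + egfQ 0) =
      C (r / 2) * rescale 2 (PowerSeries.sin K) * (rescale 3 (PowerSeries.cos K))⁻¹ := by
  have hXp := den_mul_inv r
  have hc := egfQ_zero_mul_cos (K := K)
  have hQ3 := rescale_three_egfQ_zero_mul (K := K)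
  have hr' : (C r : K⟦X⟧) ^ 2 = 3 := by rw [← map_pow, hr, map_ofNat]
  have h2 : (C (2 : K)⁻¹ : K⟦X⟧) * 2 = 1 := by
    rw [← map_ofNat C 2, ← map_mul, inv_mul_cancel₀ (two_ne_zero), map_one]
  have h4 : (C (4 : K)⁻¹ : K⟦X⟧) * 4 = 1 := by
    rw [← map_ofNat C 4, ← map_mul, inv_mul_cancel₀ (by norm_num), map_one]
  have hC3 := rescale_three_cos (K := K)
  have hY : rescale 3 (PowerSeries.cos K) * (rescale 3 (PowerSeries.cos K))⁻¹ = 1 :=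
    PowerSeries.mul_inv_cancel _ (by
      rw [hC3, map_sub, map_pow, map_mul, map_mul, map_pow, constantCoeff_cos_eq, constantCoeff_sin_eq]; norm_num)
  have hsc := sin_sq_add_cos_sq_eq (K := K)
  apply mul_right_cancel₀ (cos_three_poly_ne_zero (K := K))
  rw [egfQ_eq r, div_eq_mul_inv, map_mul, rescale_two_sin]
  set s := PowerSeries.sin K
  set c := PowerSeries.cos K
  set Xp := (c - C r * s)⁻¹
  set ci := egfQ (0 : K)
  set Q3 := rescale 3 (egfQ (0 : K))
  set C3r := rescale 3 c
  set Y := C3r⁻¹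
  set ι₂ : K⟦X⟧ := C (2 : K)⁻¹
  set ι₄ : K⟦X⟧ := C (4 : K)⁻¹
  linear_combination ((c + C r * s) * c) * hXp + (s ^ 2 * c * Xp) * hr' - 3 * ι₄ * hQ3 -
    ι₄ * (c ^ 2 - 3 * s ^ 2) * hc - c ^ 2 * h4 - C r * s * c * h2 + 3 * ι₄ * hsc - 2 * C r * ι₂ * s * c * hY +
    2 * C r * ι₂ * s * c * Y * hC3

/-! ### §2 Theorem 3.2: `Pₙ(√3)` (`n` odd) and `Qₙ(√3)` (`n` even) -/

omit [CharZero K] in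
/-- `P_n(0)` as an element of `K`: the constant coefficient. [cite: Hoffman1999DerivativePolynomials, §3 («P_n(0) and Q_n(0) are respectively the tangent and secant numbers»)] -/
theorem aeval_zero_P_eq (n : ℕ) :
    Polynomial.aeval (0 : K) (TangentNumbers.P n) = (((TangentNumbers.P n).eval 0 : ℕ) : K) := by
  rw [aeval_zero_nat, Polynomial.coeff_zero_eq_eval_zero]

omit [CharZero K] in
/-- `Q_n(0)` as an element of `K`. [cite: Hoffman1999DerivativePolynomials, §3 («P_n(0) and Q_n(0) are respectively the tangent and secant numbers»)] -/
theorem aeval_zero_Q_eq (n : ℕ) :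
    Polynomial.aeval (0 : K) (TangentNumbers.Q n) = (((TangentNumbers.Q n).eval 0 : ℕ) : K) := by
  rw [aeval_zero_nat, Polynomial.coeff_zero_eq_eval_zero]

/-- The coefficient of `tⁿ/n!` in the symmetrised (6): `Pₙ(r) + Pₙ(−r) + Pₙ(0) = 3ⁿ⁺¹Pₙ(0)` (`r² = 3`).
[cite: Hoffman1999DerivativePolynomials, §3 proof of Theorem 3.2 («(i) follows from consideration of the coefficient of tⁿ/n!»)] -/
theorem aeval_P_add_aeval_neg_P {r : K} (hr : r ^ 2 = 3) (n : ℕ) :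
    Polynomial.aeval r (TangentNumbers.P n) + Polynomial.aeval (-r) (TangentNumbers.P n) +
        Polynomial.aeval 0 (TangentNumbers.P n) = 3 ^ (n + 1) * Polynomial.aeval 0 (TangentNumbers.P n) := by
  have h := egfP_add_egfP_neg_add hr
  rw [show (3 : K⟦X⟧) = C (3 : K) from (map_ofNat C 3).symm] at h
  have hn := PowerSeries.ext_iff.1 h n
  rw [map_add, map_add, coeff_egfP, coeff_egfP, coeff_egfP, coeff_C_mul, coeff_rescale, coeff_egfP, ← add_div,
    ← add_div, mul_div_assoc', mul_div_assoc', div_left_inj' (Nat.cast_ne_zero.2 (Nat.factorial_ne_zero n))] at hn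
  rw [hn, pow_succ]
  ring

/-- ★★★ **Theorem 3.2 (i)**: if `n` is odd, `Pₙ(√3) = ½(3ⁿ⁺¹ − 1)Pₙ(0)` — for any `r` with `r² = 3` in a field of
characteristic `0`. [cite: Hoffman1999DerivativePolynomials, §3 Theorem 3.2(i) («If n is odd, P_n(√3) = ½(3^{n+1} − 1)P_n(0)»)] -/
theorem aeval_sqrt_three_P {r : K} (hr : r ^ 2 = 3) {n : ℕ} (hn : Odd n) :
    Polynomial.aeval r (TangentNumbers.P n) = (3 ^ (n + 1) - 1) / 2 * (((TangentNumbers.P n).eval 0 : ℕ) : K) := by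
  have h := aeval_P_add_aeval_neg_P hr n
  rw [aeval_neg_P, (hn.add_one).neg_one_pow, one_mul, aeval_zero_P_eq] at h
  linear_combination h / 2

/-- The coefficient of `tⁿ/n!` in the symmetrised (7): `2(Qₙ(r) + Qₙ(−r)) = (3ⁿ⁺¹ + 1)Qₙ(0)` (`r² = 3`).
[cite: Hoffman1999DerivativePolynomials, §3 proof of Theorem 3.2 («from which (ii) follows»)] -/
theorem aeval_Q_add_aeval_neg_Q {r : K} (hr : r ^ 2 = 3) (n : ℕ) :
    2 * (Polynomial.aeval r (TangentNumbers.Q n) + Polynomial.aeval (-r) (TangentNumbers.Q n)) =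
      (3 ^ (n + 1) + 1) * Polynomial.aeval 0 (TangentNumbers.Q n) := by
  have h := two_mul_egfQ_add_egfQ_neg hr
  rw [show (3 : K⟦X⟧) = C (3 : K) from (map_ofNat C 3).symm, show (2 : K⟦X⟧) = C (2 : K) from (map_ofNat C 2).symm] at h
  have hn := PowerSeries.ext_iff.1 h n
  rw [coeff_C_mul, map_add, map_add, coeff_egfQ, coeff_egfQ, coeff_C_mul, coeff_rescale, coeff_egfQ,
    ← add_div, mul_div_assoc', mul_div_assoc', mul_div_assoc', ← add_div,
    div_left_inj' (Nat.cast_ne_zero.2 (Nat.factorial_ne_zero n))] at hn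
  rw [hn, pow_succ]
  ring

/-- ★★★ **Theorem 3.2 (ii)**: if `n` is even, `Qₙ(√3) = ¼(3ⁿ⁺¹ + 1)Qₙ(0)` (any `r` with `r² = 3`).
[cite: Hoffman1999DerivativePolynomials, §3 Theorem 3.2(ii) («If n is even, Q_n(√3) = ¼(3^{n+1} + 1)Q_n(0)»)] -/
theorem aeval_sqrt_three_Q {r : K} (hr : r ^ 2 = 3) {n : ℕ} (hn : Even n) :
    Polynomial.aeval r (TangentNumbers.Q n) = (3 ^ (n + 1) + 1) / 4 * (((TangentNumbers.Q n).eval 0 : ℕ) : K) := by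
  have h := aeval_Q_add_aeval_neg_Q hr n
  rw [aeval_neg_Q, hn.neg_one_pow, one_mul, aeval_zero_Q_eq] at h
  linear_combination h / 4

/-! ### §3 Theorem 3.3: `Pₙ(√3)` (`n` even) and `Qₙ(√3)` (`n` odd) from the tangent and secant numbers -/

/-- ★★ **Theorem 3.3 (i)**: if `n > 0` is even, `Pₙ(√3) = (√3/2) Σ_{k odd} binom(n,k)(3^{k+1} − 1)P_k(0)P_{n−k}(0)`
(Theorem 2.2(i) at `s = π/3`, `u = 0`, then Theorem 3.2(i) for the odd `k` and `P_{n−k}(0) = 0` for the even `k`).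
[cite: Hoffman1999DerivativePolynomials, §3 Theorem 3.3(i) («If n > 0 is even, P_n(√3) = (√3/2) Σ_{k odd} binom(n,k)(3^{k+1} − 1)P_k(0)P_{n−k}(0)»)] -/
theorem aeval_sqrt_three_P_even {r : K} (hr : r ^ 2 = 3) {n : ℕ} (hn : Even n) (h0 : n ≠ 0) :
    Polynomial.aeval r (TangentNumbers.P n) = r / 2 * ∑ k ∈ (range (n + 1)).filter Odd,
      (n.choose k : K) * (3 ^ (k + 1) - 1) * (((TangentNumbers.P k).eval 0 : ℕ) : K) *
        (((TangentNumbers.P (n - k)).eval 0 : ℕ) : K) := by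
  have h := aeval_tanAdd_P (K := K) (u := 0) (w := r) (by simp) n
  rw [tanAdd_zero_left, if_neg h0, add_zero, aeval_zero_P_eq, eval_zero_P, if_pos hn, Nat.cast_zero, sub_eq_zero]
    at h
  have key : ∑ k ∈ range (n + 1), (n.choose k : K) * Polynomial.aeval r (TangentNumbers.P k) *
      Polynomial.aeval 0 (TangentNumbers.P (n - k)) = 1 / 2 * ∑ k ∈ range (n + 1),
        if Odd k then (n.choose k : K) * (3 ^ (k + 1) - 1) * (((TangentNumbers.P k).eval 0 : ℕ) : K) *
          (((TangentNumbers.P (n - k)).eval 0 : ℕ) : K) else 0 := by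
    rw [mul_sum]
    refine sum_congr rfl fun k hk => ?_
    have hkn : k ≤ n := Nat.lt_succ_iff.1 (mem_range.1 hk)
    rcases Nat.even_or_odd k with he | ho
    · have hnk : Even (n - k) := by
        obtain ⟨a, rfl⟩ := hn; obtain ⟨b, rfl⟩ := he; exact ⟨a - b, by omega⟩
      rw [if_neg (Nat.not_odd_iff_even.2 he), aeval_zero_P_eq (n - k), eval_zero_P, if_pos hnk]
      simp
    · rw [if_pos ho, aeval_sqrt_three_P hr ho, aeval_zero_P_eq]
      ring
  rw [h, sum_filter, key]
  ring

/-- ★★ **Theorem 3.3 (ii)**: if `n` is odd, `Qₙ(√3) = (√3/8) Σ_{k odd} binom(n,k)(3^{k+1} − 1)P_k(0)Q_{n−k}(0)`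
(Theorem 2.2(ii) at `s = π/3`, `u = −√3`, where `P(−√3, π/3) = 0`; parity (Theorem 2.1) and Theorem 3.2(i)).
[cite: Hoffman1999DerivativePolynomials, §3 Theorem 3.3(ii) («If n is odd, Q_n(√3) = (√3/8) Σ_{k odd} binom(n,k)(3^{k+1} − 1)P_k(0)Q_{n−k}(0)»; «proceed similarly after setting s = π/3 and u = −√3 in Theorem 2.2(ii)»)] -/
theorem aeval_sqrt_three_Q_odd {r : K} (hr : r ^ 2 = 3) {n : ℕ} (hn : Odd n) :
    Polynomial.aeval r (TangentNumbers.Q n) = r / 8 * ∑ k ∈ (range (n + 1)).filter Odd,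
      (n.choose k : K) * (3 ^ (k + 1) - 1) * (((TangentNumbers.P k).eval 0 : ℕ) : K) *
        (((TangentNumbers.Q (n - k)).eval 0 : ℕ) : K) := by
  have hne : (-r) * r ≠ 1 := by
    rw [neg_mul, ← sq, hr]; norm_num
  have h := aeval_tanAdd_Q (K := K) hne n
  have h0 : tanAdd (-r) r = 0 := by simp [tanAdd]
  rw [h0, aeval_zero_Q_eq, eval_zero_Q, if_neg (Nat.not_even_iff_odd.2 hn), Nat.cast_zero, zero_sub, aeval_neg_Q,
    hn.neg_one_pow, neg_mul, ← sq, hr] at h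
  -- `h : -(r * S) = (1 + 3) * (-1 * Qₙ(r))`; evaluate the sum `S`
  have hS : ∑ k ∈ range (n + 1), (n.choose k : K) * Polynomial.aeval (0 : K) (TangentNumbers.Q k) *
      Polynomial.aeval (-r) (TangentNumbers.P (n - k)) = 1 / 2 * ∑ k ∈ (range (n + 1)).filter Odd,
        (n.choose k : K) * (3 ^ (k + 1) - 1) * (((TangentNumbers.P k).eval 0 : ℕ) : K) *
          (((TangentNumbers.Q (n - k)).eval 0 : ℕ) : K) := by
    rw [sum_filter, mul_sum, ← sum_range_reflect]
    refine sum_congr rfl fun j hj => ?_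
    have hjn : j ≤ n := Nat.lt_succ_iff.1 (mem_range.1 hj)
    rw [show n + 1 - 1 - j = n - j by omega, Nat.sub_sub_self hjn, Nat.choose_symm hjn, aeval_zero_Q_eq,
      aeval_neg_P]
    rcases Nat.even_or_odd j with he | ho
    · have hnj : Odd (n - j) := by
        obtain ⟨a, rfl⟩ := hn; obtain ⟨b, rfl⟩ := he; exact ⟨a - b, by omega⟩
      rw [if_neg (Nat.not_odd_iff_even.2 he), eval_zero_Q, if_neg (Nat.not_even_iff_odd.2 hnj)]
      simp
    · rw [if_pos ho, (ho.add_one).neg_one_pow, one_mul, aeval_sqrt_three_P hr ho]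
      ring
  rw [hS] at h
  linear_combination (1 / 4 : K) * h

end Field

/-! ### §4 Over `ℝ` with `r = √3`, and first values -/

section Real

/-- Theorem 3.2 over `ℝ`: `Pₙ(√3) = ½(3ⁿ⁺¹ − 1)Pₙ(0)` for odd `n` and `Qₙ(√3) = ¼(3ⁿ⁺¹ + 1)Qₙ(0)` for even `n`.
[cite: Hoffman1999DerivativePolynomials, §3 Theorem 3.2] -/
theorem aeval_real_sqrt_three (n : ℕ) :
    (Odd n → Polynomial.aeval (Real.sqrt 3) (TangentNumbers.P n) =
        (3 ^ (n + 1) - 1) / 2 * (((TangentNumbers.P n).eval 0 : ℕ) : ℝ)) ∧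
      (Even n → Polynomial.aeval (Real.sqrt 3) (TangentNumbers.Q n) =
        (3 ^ (n + 1) + 1) / 4 * (((TangentNumbers.Q n).eval 0 : ℕ) : ℝ)) :=
  have hr : Real.sqrt 3 ^ 2 = 3 := Real.sq_sqrt (by norm_num)
  ⟨fun hn => aeval_sqrt_three_P hr hn, fun hn => aeval_sqrt_three_Q hr hn⟩

/-- First values: `P₁(√3) = 4 = ½(9−1)·1`, `P₃(√3) = 80 = ½(81−1)·2`, `Q₂(√3) = 7 = ¼(27+1)·1`
(`P₁(0) = 1`, `P₃(0) = 2`, `Q₂(0) = 1`). [cite: Hoffman1999DerivativePolynomials, §3 Theorem 3.2] -/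
theorem aeval_sqrt_three_values {K : Type*} [Field K] [CharZero K] {r : K} (hr : r ^ 2 = 3) :
    Polynomial.aeval r (TangentNumbers.P 1) = 4 ∧ Polynomial.aeval r (TangentNumbers.P 3) = 80 ∧
      Polynomial.aeval r (TangentNumbers.Q 2) = 7 := by
  have h1 : (TangentNumbers.P 1).eval 0 = 1 := by rw [eval_zero_P]; decide
  have h3 : (TangentNumbers.P 3).eval 0 = 2 := by rw [eval_zero_P]; decide
  have h2 : (TangentNumbers.Q 2).eval 0 = 1 := by rw [eval_zero_Q]; decide
  refine ⟨?_, ?_, ?_⟩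
  · rw [aeval_sqrt_three_P hr (by decide), h1]; norm_num
  · rw [aeval_sqrt_three_P hr (by decide), h3]; norm_num
  · rw [aeval_sqrt_three_Q hr (by decide), h2]; norm_num

end Real

end DerivativePolynomials
end Literature.Combinatorics.Enumerative
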